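import Literature.AnabelianGeometry.SemiGraphs.SgACoveringHomCanPointAlignment
import Literature.AnabelianGeometry.SemiGraphs.AmbientVocabReal
import Literature.AnabelianGeometry.SemiGraphs.CoverticialRemark241OfRigidity
import Literature.AnabelianGeometry.Anabelioids.FiberFunctorUnique
import Literature.AnabelianGeometry.Anabelioids.FiniteEtaleLocalDictionary
import HarnessLib

/-!
# [SemiAnbd] Def. 3.5 (ii) in the ambient category of §§4–5: the arrow of print's constructed covering
# `𝒢_A → G` is a TEMPERED COVERING (`SgA.IsTemperedCoveringOf`) — law L1 of the (R1) bridge at print's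
# coverings (bridge brick L1e, definition layer)

Mochizuki, *Semi-graphs of anabelioids*, Publ. RIMS **42** (2006), Def. 2.2 (i) p. 23 (the finite étale
covering `𝒢' → 𝒢` ATTACHED TO `G' ∈ Ob(B(𝒢))`), Rmk. 2.4.1 p. 26, Def. 3.5 (i)/(ii) p. 37 ("we have
natural full embeddings `B(G) ↪ B^temp(G) ↪ B^cov(G)`"; "coverings … that arise from finite objects
of `B^cov(G)` determine 'finite étale coverings'") (kurims `paper:url-f33ace170ff4`).
[cite: MochizukiSemiAnbd2006, Def 3.5(ii) p.37]

Assembly of the (R1) bridge law L1 «finite étale ⇒ tempered» (HOME/staging/L3/L3-t3/R1-BRIDGE-SHAPES.md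
§4; interface owner abc-iut-L3-t3) FOR PRINT'S CONSTRUCTED COVERINGS, over `BObj.isoOverCan` /
`exists_isTempered_isoOver_can` (`SgACoveringHomCanPointAlignment.lean`):

* `BObj.coveringGraph_isTotallyAloof` (f-161's `remark_2_4_1_coveringHomCan`),
  `BObj.coveringGraph_isVerticiallySlim` (the vertex groups of `𝒢_A` embed openly into the slim
  vertex groups of `ℋ`: `range = Stab(y)`), `BObj.coveringGraph_everyEdgeAbuts` (proper base),
  `BObj.coveringHomCan_isLocallyOpen` (finite étale constituents have open images `Stab(y)`) — the
  constructed covering `𝒢_A` of an object `G` of the ambient category `SgA` IS an object of `SgA` and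
  `𝒢_A → G` an arrow of it:
* `SgA.coveringObj G A : SgA`, `SgA.coveringArrow G A : coveringObj G A ⟶ G`;
* `SgA.finiteEtale_coveringArrow` — it is a finite étale arrow in print's four-clause sense (abc-iut-L3-t1's
  `coveringHomCan_isFiniteEtaleCoveringGlobal`), i.e. in the FIRST disjunct of `SgA.IsTemperedArrow`;
* `SgA.isTemperedCoveringOf_coveringArrow` — **for `G` connected and countable it is a TEMPERED
  COVERING** (`SgA.IsTemperedCoveringOf`, the SECOND disjunct): for print's constructed coverings the
  first disjunct of `SgA.IsTemperedArrow` (M8 `AmbientVocabReal.lean`) is REDUNDANT — the kernel form of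
  "`B(G) ↪ B^temp(G)`" at one universe.

What remains parametric (recorded, not asserted): the same for the cell's ABSTRACT four-clause
coverings `Hom.IsFiniteEtaleCoveringGlobal` needs their comparison with `𝒢_A` (the rigidity junction
(J1) of `CoverticialRemark241OfRigidity.lean`); the point-system route of `CoveringGraphIsoOver.lean`
reduces it to the profinite point alignment (PS3) of their 2-cells.  Nothing of the paper is asserted;
no side taken on [IUTchIII] Cor. 3.12.
-/

noncomputable section

namespace Literature.AnabelianGeometry.SemiGraphs

open CategoryTheory CategoryTheory.Limits CategoryTheory.PreGaloisCategory
open Literature.AnabelianGeometry.Anabelioids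
open Literature.AlgebraicGeometry.Frobenioids (IsSlimGroup)

universe u

namespace SemiGraphOfAnabelioids

namespace BObj

variable {ℋ : SemiGraphOfAnabelioids.{u, u, u}} (A : ℋ.BObj)

/-! ### `𝒢_A` inherits the three properties of the ambient category -/

/-- `𝒢_A` is totally aloof if `ℋ` is (Rmk. 2.4.1 along print's constructed covering, f-161's
`remark_2_4_1_coveringHomCan`, third clause). [cite: MochizukiSemiAnbd2006, Rem. 2.4.1 p.26] -/
theorem coveringGraph_isTotallyAloof (h : ℋ.IsTotallyAloof) : A.coveringGraph.IsTotallyAloof :=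
  ⟨fun ec => (A.remark_2_4_1_coveringHomCan).2.2.1 ec (h.isAloof _)⟩

/-- In `𝒢_A` every edge abuts to a vertex if this holds in `ℋ` (the base `𝔾_A → 𝔾` is proper:
abutting branches lift). [cite: MochizukiSemiAnbd2006, Def. 2.2(i) p.23] -/
theorem coveringGraph_everyEdgeAbuts (h : ℋ.EveryEdgeAbuts) : A.coveringGraph.EveryEdgeAbuts := by
  intro ec
  obtain ⟨b, v, hbe, hbv⟩ := h (A.fibreData.proj.edgeMap ec)
  obtain ⟨bc, vc, hbc, -, habuts, -⟩ :=
    SemiGraph.exists_branch_preimage_abuts A.fibreData.proj A.isProper_can ec b hbe v hbv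
  exact ⟨bc, vc, hbc, habuts⟩

/-- The image of `Π_{𝒢_A, vc} → Π_{ℋ, v}` (along the chosen path) is OPEN: it is the stabiliser of the
canonical point `yCan vc` of the finite continuous `Π_{ℋ,v}`-set `F_v(S_v)`.
[cite: MochizukiSemiAnbd2006, Rem. 2.2.1 p.24] -/
theorem isOpen_range_hVProfinite_can (vc : A.fibreData.total.Vertex) :
    IsOpen (Set.range (A.coveringHomCan.over.hVProfinite vc)) := by
  have h : Set.range (A.coveringHomCan.over.hVProfinite vc) =
      (MulAction.stabilizer (Aut (ℋ.fibV (A.fibreData.proj.vertexMap vc))) (A.yCan vc) :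
        Set (Aut (ℋ.fibV (A.fibreData.proj.vertexMap vc)))) := by
    rw [← A.range_hVProfinite_can vc]; exact (MonoidHom.coe_range _).symm
  rw [h]
  exact isOpen_stabilizer_fiber _ _ _

/-- The edge version. [cite: MochizukiSemiAnbd2006, Rem. 2.2.1 p.24] -/
theorem isOpen_range_hEAt_can (ec : A.fibreData.total.Edge) :
    IsOpen (Set.range (A.coveringHomCan.over.hEAt ec (A.fibreData.proj.edgeMap ec) rfl)) := by
  have h : Set.range (A.coveringHomCan.over.hEAt ec (A.fibreData.proj.edgeMap ec) rfl) =
      (MulAction.stabilizer (Aut (ℋ.fibE (A.fibreData.proj.edgeMap ec))) (A.zCan ec) :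
        Set (Aut (ℋ.fibE (A.fibreData.proj.edgeMap ec)))) := by
    rw [← A.range_hEAt_can ec]; exact (MonoidHom.coe_range _).symm
  rw [h]
  exact isOpen_stabilizer_fiber _ _ _

/-- **Print's constructed covering `𝒢_A → ℋ` is locally open** (its constituents are finite étale:
their images on `π̂₁` are the open stabilisers; basepoint-independence by B2's
`isLocallyOpen_toProfinite_iff`). [cite: MochizukiSemiAnbd2006, Def 2.2(ii) p.24] -/
theorem coveringHomCan_isLocallyOpen : A.coveringHomCan.IsLocallyOpen :=
  (HomOver.isLocallyOpen_toProfinite_iff A.coveringHomCan.over).mp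
    ⟨fun vc => A.isOpen_range_hVProfinite_can vc, fun ec => A.isOpen_range_hEAt_can ec⟩

/-- **`𝒢_A` is verticially slim if `ℋ` is**: the vertex group `Π_{𝒢_A,vc}` embeds, as a topological
group, onto the OPEN subgroup `Stab(yCan vc)` of the slim `Π_{ℋ,v}` (an injective continuous
homomorphism of profinite groups with open image is an open map onto its image), and a group
embedding openly into a slim group is slim (open subgroups go to open subgroups, centralisers to
centralisers). [cite: MochizukiSemiAnbd2006, Def. 2.4(ii) p.25] -/
theorem coveringGraph_isVerticiallySlim (h : ℋ.IsVerticiallySlim) : A.coveringGraph.IsVerticiallySlim := by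
  refine ⟨fun vc => (isSlim_iff_isSlimGroup_aut (A.coveringGraph.fibV vc)).mpr ?_⟩
  have hB : IsSlimGroup (Aut (ℋ.fibV (A.coveringHomCan.base.vertexMap vc))) :=
    (isSlim_iff_isSlimGroup_aut (ℋ.fibV (A.coveringHomCan.base.vertexMap vc))).mp (h.isSlim _)
  let j := A.coveringHomCan.over.hVProfinite vc
  have hinj : Function.Injective j := A.hVProfinite_injective_can vc
  have hemb : _root_.Topology.IsClosedEmbedding j := j.continuous.isClosedEmbedding hinj
  have hopen : IsOpenMap j := hemb.isInducing.isOpenMap (A.isOpen_range_hVProfinite_can vc)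
  refine ⟨fun U hU => ?_⟩
  rw [eq_bot_iff]
  intro z hz
  have hzU := Subgroup.mem_centralizer_iff.mp hz
  have hUo : IsOpen ((U.map j.toMonoidHom : Set (Aut (ℋ.fibV (A.coveringHomCan.base.vertexMap vc))))) := by
    rw [Subgroup.coe_map]
    exact hopen _ hU
  have hc := hB.centralizer_eq_bot (U.map j.toMonoidHom) hUo
  have hjz : j z ∈ Subgroup.centralizer
      (U.map j.toMonoidHom : Set (Aut (ℋ.fibV (A.coveringHomCan.base.vertexMap vc)))) := by
    rw [Subgroup.mem_centralizer_iff]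
    rintro _ ⟨w, hw, rfl⟩
    change j w * j z = j z * j w
    rw [← map_mul, ← map_mul, hzU w hw]
  rw [hc, Subgroup.mem_bot] at hjz
  rw [Subgroup.mem_bot]
  exact hinj (by rw [hjz, map_one])

end BObj

end SemiGraphOfAnabelioids

/-! ### The arrow of print's constructed covering in the ambient category, and law L1 for it -/

namespace SgAQuot.SgA

open SemiGraphOfAnabelioids ProfiniteSemiGraph

variable (G : SgA.{u, u, u}) (A : G.toSgA.BObj)

/-- **`𝒢_A` as an object of the ambient category `SgA` of §§4–5** (totally aloof, verticially slim,
every edge abutting, all inherited from `G`). [cite: MochizukiSemiAnbd2006, Def. 2.2(i) p.23] -/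
def coveringObj : SgA.{u, u, u} :=
  SgA.ofSgA A.coveringGraph (A.coveringGraph_isTotallyAloof G.isTotallyAloof)
    (A.coveringGraph_isVerticiallySlim G.isVerticiallySlim)
    (A.coveringGraph_everyEdgeAbuts G.everyEdgeAbuts)

/-- The underlying semi-graph of anabelioids of `coveringObj G A` is `𝒢_A`.
[cite: MochizukiSemiAnbd2006, Def. 2.2(i) p.23] -/
@[simp] theorem coveringObj_toSgA : (coveringObj G A).toSgA = A.coveringGraph := rfl

/-- **The arrow `𝒢_A → G` of print's constructed covering in `SgA`** (the class of the locally open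
1-morphism `coveringHomCan A`). [cite: MochizukiSemiAnbd2006, Def. 2.2(i) p.23] -/
def coveringArrow : coveringObj G A ⟶ G :=
  SgA.homOfHom (X := coveringObj G A) (Y := G) A.coveringHomCan A.coveringHomCan_isLocallyOpen

/-- Its underlying `SgAQuot`-arrow is the class of `coveringHomCan A`.
[cite: MochizukiSemiAnbd2006, Def. 2.2(i) p.23] -/
@[simp] theorem coveringArrow_hom_hom : (coveringArrow G A).hom.hom = SgAQuot.homOf A.coveringHomCan := rfl

/-- The arrow of print's constructed covering is FINITE ÉTALE in print's four-clause sense (abc-iut-L3-t1's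
`coveringHomCan_isFiniteEtaleCoveringGlobal`) — the first disjunct of `SgA.IsTemperedArrow`.
[cite: MochizukiSemiAnbd2006, Def. 2.2(i) p.23] -/
theorem finiteEtale_coveringArrow : finiteEtale (coveringArrow G A).hom.hom :=
  homOf_mem_finiteEtale _ A.coveringHomCan_isFiniteEtaleCoveringGlobal

/-- **Law L1 of the (R1) bridge for print's constructed coverings: `𝒢_A → G` is a TEMPERED COVERING
of `G` in the ambient category** (`SgA.IsTemperedCoveringOf`, Def. 3.5 (ii) read on profinite
presentations: isomorphic over `G` to the covering of the tempered — indeed finite — object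
`toCovObj A` of `B^cov(G)`), for `G` connected and countable ("`B(G) ↪ B^temp(G)`").
[cite: MochizukiSemiAnbd2006, Def 3.5(ii) p.37] -/
theorem isTemperedCoveringOf_coveringArrow (hc : G.toSgA.graph.IsConnected)
    (hκ : G.toSgA.graph.IsCountable) : IsTemperedCoveringOf (coveringArrow G A) := by
  rw [isTemperedCoveringOf_indep (coveringArrow G A) A.coveringHomCan.over rfl]
  exact A.exists_isTempered_isoOver_can hc hκ

/-- … hence a tempered arrow of `SemiAnbdVocab.real` through the SECOND disjunct as well: for print's
constructed coverings the first disjunct of `SgA.IsTemperedArrow` is redundant.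
[cite: MochizukiSemiAnbd2006, Def 3.5(ii) p.37] -/
theorem isTemperedArrow_coveringArrow_of_isTemperedCoveringOf (hc : G.toSgA.graph.IsConnected)
    (hκ : G.toSgA.graph.IsCountable) : IsTemperedArrow (coveringArrow G A) :=
  isTemperedArrow_of_isTemperedCoveringOf _ (isTemperedCoveringOf_coveringArrow G A hc hκ)

end SgAQuot.SgA

end Literature.AnabelianGeometry.SemiGraphs

end
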